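import Summits.QuantumFields.YangMills.Theorems.PoincareLipschitzGradientLimitPotential
import Summits.QuantumFields.YangMills.Theorems.PoincareLipschitzSobolevInversionLetters
import Literature.Analysis.FunctionSpaces.Mollification
import Literature.Analysis.FunctionSpaces.MollificationLp
import Mathlib.MeasureTheory.Function.L2Space
import Mathlib.MeasureTheory.Function.ConvergenceInMeasure
import HarnessLib

/-!
# Finite Dirichlet energy forces `L²_loc`: a function with a whole-space weak gradient in `L²` is locally `L²`

Helper file (K2 lane of crux `stmt-QuantumFields-19936` `HistoryTailL` ∕ crux `stmt-QuantumFields-23533`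
`BlockLipschitzL`, LINE 25 «CompactnessTransfer», ROAD (W); cure (β) of the road owner's row (i′)).  YM₃ on
the unit 3-torus is rung R3 of the ladder — NOT `d = 4`, NOT infinite volume, NOT a mass gap, NOT the
Clay problem; nothing here bears on those.

Let `E` be a finite-dimensional real inner product space with Lebesgue measure, `u : E → ℝ` with a
weak derivative `Gu` on the whole space (lit `HasWeakFDerivOn`, so `u, Gu ∈ L¹_loc`) and
`Gu ∈ L²(E)`.  Then `u² ∈ L¹_loc` (`locallyIntegrable_sq_of_hasWeakFDerivOn_of_memLp`); planar
corollary with the energy written as `Σ_k (Gu e_k)²` (`locallyIntegrable_sq_of_hasWeakFDerivOn_of_energy`).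
So the row (i′) `LocallyIntegrable (B ·)²` of the `3π`-socket ∕ DOOR-TWO ∕ W-ONE is a CONSEQUENCE of rows
(i)+(ii) and may be dropped by their owners.

Proof: mollify, `u_n = φ_n ⋆ u` (lit ✓`Mollification`: `D(φ ⋆ u) = φ ⋆ Gu`, smoothness), so
`‖Du_n − Gu‖_{L²} → 0` (lit ✓`MollificationLp.tendsto_eLpNorm_normed_convolution_sub_self`); the
closure-of-gradients theorem ✓`PoincareLipschitzGradientLimitPotential.exists_potential_of_tendsto_fderiv`
gives `B ∈ L²_loc` with `u_n − ⨍_{B(0,1)} u_n → B` in `L²_loc`; along a subsequence this holds a.e.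
(convergence in measure), while `u_n → u` a.e. (Lebesgue points, lit ✓`ae_tendsto_normed_convolution`);
hence the CONSTANTS `⨍_{B(0,1)} u_n` converge and `u = B + const` a.e., so `u ∈ L²_loc`.

References: L. C. Evans, *PDE* (2010), §5.3.1, §5.8.1; V. G. Maz'ya, *Sobolev Spaces* (1985), §1.1.13.
-/

noncomputable section

open MeasureTheory Set Filter Metric TopologicalSpace Module
open scoped ENNReal NNReal Topology Convolution ContDiff

namespace Summit.QuantumFields.YangMills.Theorems.PoincareLipschitzSobolevLocalL2OfEnergy

open Literature.Analysis.FunctionSpaces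
open Summit.QuantumFields.YangMills.Theorems.PoincareLipschitzGradientLimitPotential
open Summit.QuantumFields.YangMills.Theorems.PoincareLipschitzSobolevInversion (clm_apply_eq_sum)

variable {E : Type*} [NormedAddCommGroup E] [InnerProductSpace ℝ E] [FiniteDimensional ℝ E]
  [MeasurableSpace E] [BorelSpace E]

omit [NormedAddCommGroup E] [InnerProductSpace ℝ E] [FiniteDimensional ℝ E] [BorelSpace E] in
/-- A real sequence which converges, for almost every point of a set of positive measure, to the
value of a function there, converges; and that function is then a.e. constant on the set. [folklore] -/
theorem exists_lim_of_ae_tendsto_const {ν : Measure E} (hν : ν ≠ 0) {c : ℕ → ℝ} {f : E → ℝ}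
    (h : ∀ᵐ x ∂ν, Tendsto c atTop (𝓝 (f x))) : ∃ L : ℝ, Tendsto c atTop (𝓝 L) ∧ ∀ᵐ x ∂ν, f x = L := by
  haveI : (ae ν).NeBot := ae_neBot.2 hν
  obtain ⟨x₀, hx₀⟩ := h.exists
  exact ⟨f x₀, hx₀, h.mono fun x hx => tendsto_nhds_unique hx hx₀⟩

/-- **Finite Dirichlet energy forces `L²_loc`.** If `u : E → ℝ` has the weak derivative `Gu` on the
whole space and `Gu ∈ L²(E)`, then `u² ∈ L¹_loc(E)`. [cite: Evans2010, §5.8.1 Thm. 1] -/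
theorem locallyIntegrable_sq_of_hasWeakFDerivOn_of_memLp {u : E → ℝ} {Gu : E → E →L[ℝ] ℝ}
    (hu : HasWeakFDerivOn ⟨univ, isOpen_univ⟩ volume u Gu) (hGu : MemLp Gu 2 volume) :
    LocallyIntegrable (fun y => u y ^ 2) volume := by
  -- whole-space weak derivative in the `⊤` spelling of the mollification file
  have hu' : HasWeakFDerivOn (⊤ : Opens E) volume u Gu :=
    HasWeakFDerivOn.mono_set_holds hu (fun _ _ => trivial)
  have hul : LocallyIntegrable u volume := by
    simpa [locallyIntegrableOn_univ] using hu.locallyIntegrableOn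
  have hum : AEStronglyMeasurable u volume := hul.aestronglyMeasurable
  have hGm : AEStronglyMeasurable Gu volume := hGu.1
  -- mollifiers
  obtain ⟨φ, hφ0, hφ2⟩ := exists_contDiffBump_seq (E := E)
  set w : ℕ → E → ℝ := fun n => (φ n).normed volume ⋆[ContinuousLinearMap.lsmul ℝ ℝ, volume] u with hw
  have hwC : ∀ n, ContDiff ℝ 1 (w n) := fun n => hu'.contDiff_convolution (isTestFunctionOn_normed (φ n))
  have hwD : ∀ n, fderiv ℝ (w n) = (φ n).normed volume ⋆[ContinuousLinearMap.lsmul ℝ ℝ, volume] Gu :=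
    fun n => funext fun x => (hu'.hasFDerivAt_convolution (isTestFunctionOn_normed (φ n)) x).fderiv
  have hlim : Tendsto (fun n => eLpNorm (fderiv ℝ (w n) - Gu) 2 volume) atTop (𝓝 0) := by
    simp_rw [hwD]
    exact tendsto_eLpNorm_normed_convolution_sub_self hφ0 one_le_two (by norm_num) hGu
  -- the closure-of-gradients theorem
  obtain ⟨B, hB, hconv⟩ := exists_potential_of_tendsto_fderiv volume w hwC hGm hlim
  have hBm : AEStronglyMeasurable B volume := by
    simpa using hB.locallyIntegrableOn.aestronglyMeasurable
  -- Lebesgue points: `w n → u` a.e.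
  have hae : ∀ᵐ x ∂volume, Tendsto (fun n => w n x) atTop (𝓝 (u x)) :=
    ae_tendsto_normed_convolution hφ0 hφ2 hul
  -- on each ball: `u = B + const` a.e., hence `u ∈ L²`
  refine locallyIntegrable_of_integrableOn_ball fun R => ?_
  set c : ℕ → ℝ := fun n => ⨍ y in ball (0 : E) 1, w n y ∂volume with hc
  have hR := hconv R
  haveI : IsFiniteMeasure (volume.restrict (ball (0 : E) R)) := isFiniteMeasure_restrict.2 measure_ball_lt_top.ne
  by_cases hR0 : volume (ball (0 : E) R) = 0
  · rw [IntegrableOn, Measure.restrict_eq_zero.2 hR0]; exact integrable_zero_measure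
  -- convergence in measure on the ball and an a.e.-convergent subsequence
  have hwm : ∀ n, AEStronglyMeasurable (fun x => w n x - c n) (volume.restrict (ball (0 : E) R)) := fun n =>
    ((hwC n).continuous.aestronglyMeasurable.sub aestronglyMeasurable_const)
  have hinm := tendstoInMeasure_of_tendsto_eLpNorm (μ := volume.restrict (ball (0 : E) R)) (p := 2)
    (f := fun n x => w n x - c n) (g := B) (by norm_num) hwm hBm.restrict
    (by simpa only [Pi.sub_def] using hR)
  obtain ⟨ns, hns, hsub⟩ := hinm.exists_seq_tendsto_ae
  -- the constants converge along the subsequence, to `u - B` a.e.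
  have hcl : ∀ᵐ x ∂volume.restrict (ball (0 : E) R), Tendsto (fun i => c (ns i)) atTop (𝓝 (u x - B x)) := by
    filter_upwards [hsub, ae_restrict_of_ae hae] with x h1 h2
    have h3 : Tendsto (fun i => w (ns i) x) atTop (𝓝 (u x)) := h2.comp hns.tendsto_atTop
    have : Tendsto (fun i => w (ns i) x - (w (ns i) x - c (ns i))) atTop (𝓝 (u x - B x)) := h3.sub h1
    simpa using this
  obtain ⟨L, -, hL⟩ := exists_lim_of_ae_tendsto_const (by rwa [Ne, Measure.restrict_eq_zero]) hcl
  -- `B ∈ L²(ball)`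
  obtain ⟨n, hn⟩ : ∃ n, eLpNorm (fun x => w n x - c n - B x) 2 (volume.restrict (ball (0 : E) R)) < ⊤ := by
    obtain ⟨N, hN⟩ := ENNReal.tendsto_atTop_zero.1 hR 1 one_pos
    exact ⟨N, (hN N le_rfl).trans_lt ENNReal.one_lt_top⟩
  have hcont : Continuous fun x => w n x - c n := (hwC n).continuous.sub continuous_const
  obtain ⟨M, hM⟩ := (isCompact_closedBall (0 : E) R).exists_bound_of_continuousOn hcont.continuousOn
  have hwb : MemLp (fun x => w n x - c n) 2 (volume.restrict (ball (0 : E) R)) := by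
    refine (memLp_top_of_bound hcont.aestronglyMeasurable.restrict M ?_).mono_exponent le_top
    filter_upwards [ae_restrict_mem measurableSet_ball] with x hx
    exact hM x (ball_subset_closedBall hx)
  have hdiff : MemLp (fun x => w n x - c n - B x) 2 (volume.restrict (ball (0 : E) R)) :=
    ⟨(hwm n).sub hBm.restrict, hn⟩
  have hBL2 : MemLp B 2 (volume.restrict (ball (0 : E) R)) := by
    have h := hwb.sub hdiff
    have heq : (fun x => w n x - c n) - (fun x => w n x - c n - B x) = B := by funext x; simp
    rwa [heq] at h
  -- `u = B + L` a.e. on the ball, hence `u ∈ L²(ball)`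
  have huL2 : MemLp u 2 (volume.restrict (ball (0 : E) R)) := by
    refine (hBL2.add (memLp_const L)).ae_eq ?_
    filter_upwards [hL] with x hx
    simp only [Pi.add_apply]
    linarith
  exact (memLp_two_iff_integrable_sq hum.restrict).1 huL2

/-- **Planar corollary in the energy letters of ROAD (W)**: on `E² = EuclideanSpace ℝ (Fin 2)`, if
`u` has a whole-space weak gradient `Gu` with `Σ_k (Gu e_k)²` integrable, then `u² ∈ L¹_loc` — row
(i′) of the `3π` socket follows from rows (i)+(ii). [cite: Evans2010, §5.8.1 Thm. 1] -/
theorem locallyIntegrable_sq_of_hasWeakFDerivOn_of_energy {u : EuclideanSpace ℝ (Fin 2) → ℝ}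
    {Gu : EuclideanSpace ℝ (Fin 2) → EuclideanSpace ℝ (Fin 2) →L[ℝ] ℝ}
    (hu : HasWeakFDerivOn ⟨univ, isOpen_univ⟩ volume u Gu)
    (hGu : Integrable (fun y => ∑ k : Fin 2, (Gu y (EuclideanSpace.single k 1)) ^ 2)) :
    LocallyIntegrable (fun y => u y ^ 2) volume := by
  have hGm : AEStronglyMeasurable Gu volume := by
    simpa [locallyIntegrableOn_univ] using hu.locallyIntegrableOn_deriv.aestronglyMeasurable
  refine locallyIntegrable_sq_of_hasWeakFDerivOn_of_memLp hu ((memLp_two_iff_integrable_sq_norm hGm).2 ?_)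
  -- `‖L‖² ≤ 2 Σ_k (L e_k)²` for a linear functional on the plane
  refine (hGu.const_mul 2).mono' (hGm.norm.pow 2) (Eventually.of_forall fun y => ?_)
  rw [Real.norm_eq_abs, abs_of_nonneg (sq_nonneg _)]
  have hle : ‖Gu y‖ ≤ ∑ k : Fin 2, |Gu y (EuclideanSpace.single k 1)| := by
    refine ContinuousLinearMap.opNorm_le_bound _ (Finset.sum_nonneg fun k _ => abs_nonneg _) fun v => ?_
    rw [clm_apply_eq_sum (Gu y) v, Finset.sum_mul]
    refine (norm_sum_le _ _).trans (Finset.sum_le_sum fun k _ => ?_)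
    rw [smul_eq_mul, norm_mul, Real.norm_eq_abs, Real.norm_eq_abs, mul_comm]
    exact mul_le_mul_of_nonneg_left (by simpa using PiLp.norm_apply_le v k) (abs_nonneg _)
  have h0 : 0 ≤ ‖Gu y‖ := norm_nonneg _
  rw [Fin.sum_univ_two] at hle ⊢
  nlinarith [sq_nonneg (|Gu y (EuclideanSpace.single 0 1)| - |Gu y (EuclideanSpace.single 1 1)|),
    sq_abs (Gu y (EuclideanSpace.single 0 1)), sq_abs (Gu y (EuclideanSpace.single 1 1)),
    abs_nonneg (Gu y (EuclideanSpace.single 0 1)), abs_nonneg (Gu y (EuclideanSpace.single 1 1))]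

end Summit.QuantumFields.YangMills.Theorems.PoincareLipschitzSobolevLocalL2OfEnergy

end
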